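import Literature.AlgebraicGeometry.HodgeTheory.AbelianVarietyCyclotomicAutomorphismIntegralRepresentation
import Literature.AlgebraicGeometry.HodgeTheory.AbelianVarietyTorsionPointsHomology
import Literature.AlgebraicGeometry.HodgeTheory.AbelianVarietyIntegralCohomology
-- import Literature.RingTheory.DedekindDomain.ModuleRankOverRingOfIntegers
import Mathlib.NumberTheory.NumberField.Basic
import Mathlib.LinearAlgebra.Quotient.Basic
import Mathlib.Algebra.Module.Submodule.Pointwise
import HarnessLib

/-!
# The lattice `Λ = H₁(A(ℂ); ℤ)` of a complex abelian variety with `𝒪_F`-multiplication `ι₀ : 𝒪_F → End A`: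
# an `𝒪_F`-module, finite and torsion-free, with `A[N](ℂ) ≅ Λ ∕ NΛ` `𝒪_F`-equivariantly — fixed points of `ι₀(a)` on
# `A[N](ℂ)` are counted on `Λ ∕ (N)Λ`

Topic `Literature/AlgebraicGeometry/HodgeTheory`; namespace `Literature.AlgebraicGeometry.HodgeTheory.AbelianVariety`.  THEOREMS ONLY
(no definition, no named fact, no instance, no notation, no `sorry`).  Cell `hodgecm-mathlib` (D-0151), FLOOR 0, P6 «MOD programme»
(crux hLiu418 = stmt-HodgeConjecture-24832, `--supports`): FILE 2 of the GEN organ **(S-H-A) «TATE∕BETTI-MODULE COMPARISON FOR THE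
`e_w`-COUNT»** (K∕BT desk F0P6d-plan (g2) cut v2.3 §2, socket (S-H) `hrank`; A-p18 (g30), 2026-09-01): the B-side (★ DEAL 5
`hrank_pDivisibleGroup_of_natCard_fixedPoints`) reduces the block height `2ef` of the `w`-block of `A[p^∞]` to a COUNT of the points of
`A_Ω[pⁿ]` fixed by the block idempotent `e_w = ι₀(a_n)`, and ★ DEAL 7 `natCard_fixedPoints_smul_of_linearEquiv_two` + DEAL 8
`nonempty_quotient_pow_linearEquiv_pi` compute that count on `H ∕ pⁿH` for a finite projective `𝒪_F`-module `H` of rank `2`; THIS FILE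
supplies `H := Λ = H₁(A(ℂ); ℤ)` over `ℂ`: the `𝒪_F`-module structure through the integral representation `ρ₁ = hOneRep A` (a ring
homomorphism, ★ `hOneRep_add`), its finiteness and torsion-freeness, and the transfer of the fixed-point count along the
`End(A)`-equivariant isomorphism `Λ∕NΛ ≅ A[N](ℂ)` (★ `modNHOneEquivTorsionPoints`, ★ `coe_modNHOneEquivTorsionPoints_mkQ_map`).

THE `𝒪_F`-MODULE STRUCTURE is written INSIDE every statement as
`letI : Module (𝓞 F) Λ := Module.compHom Λ ((RingHom.mk' (hOneRep A) hOneRep_add).comp ι₀)` (no instance is declared; consumers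
repeat the same `letI`; ★ DEAL 7 ∕ DEAL 8 are stated for an arbitrary `[Module O M]` and apply under it): `a • c = ρ₁(ι₀ a) c = (ι₀ a)_* c`.
HC_CM is proved only modulo the printed citations until rung 0 closes; this file is generic and changes no count.

THE PRINT.  [Shimura1998] §1.2–§1.3 and §3.1–§3.2 (a complex torus `ℂⁿ∕Λ` with an order `ι(𝔬) ⊆ End`; `Λ ⊗ ℚ` is an `F`-module; §7.1
`𝔤(𝔞, A)` = the points killed by `ι(𝔞)`, `A[N] = N⁻¹Λ∕Λ`); [Lange2023AbelianVarietiesComplex] §1.1.2 Prop. 1.1.14 («`X_n = n⁻¹Λ∕Λ ≃ Λ∕nΛ`»),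
§1.1.3 (the rational representation `ρ_r` is a faithful representation of the RING `End(X)`); [MumfordAV1970] §1 (3), §19 p. 176
(`T_ℓ A = H₁(A, ℤ) ⊗ ℤ_ℓ` over `ℂ`).

* §1 `hOne_smul_def` (`a • c = ρ₁(ι₀ a) c`), `isScalarTower_int_hOne` (for the `zsmul` action), `finite_hOne` (`Module.Finite (𝓞 F) Λ`),
  `isTorsionFree_int_hOne` (`Module.IsTorsionFree ℤ Λ`).
* §2 THE TRANSFER: `mem_span_natCast_smul_top_iff` (`(N)Λ = NΛ` as subgroups),
  **`exists_bijective_quotient_to_torsionPoints`** (an additive bijection `Λ ∕ (N)Λ → A[N](ℂ)` intertwining `a •` with `ι₀(a)` on points),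
  **`natCard_fixedPoints_torsionPoints_eq`**: `#{P ∈ A[N](ℂ) ∕∕ ι₀(a)·P = P} = #{y ∈ Λ ∕ (N)Λ ∕∕ a • y = y}`.

## References
* [Shimura1998] G. Shimura, *Abelian Varieties with Complex Multiplication and Modular Functions* (1998), §1.2–§1.3, §3.1–§3.2, §7.1.
* [Lange2023AbelianVarietiesComplex] H. Lange, *Abelian Varieties over the Complex Numbers* (2023), §1.1.2 Prop. 1.1.14, §1.1.3 (1.3).
* [MumfordAV1970] D. Mumford, *Abelian Varieties* (1970), §1 (3), §19 p. 176 and §24 p. 237 (`A[n] = n⁻¹Λ∕Λ`).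
-/

set_option autoImplicit false

noncomputable section

open CategoryTheory Module Function
open Literature.AlgebraicTopology.SingularHomology
open Literature.AlgebraicTopology.FundamentalGroup

namespace Literature.AlgebraicGeometry.HodgeTheory

namespace AbelianVariety

open Literature.AlgebraicGeometry.Motives Literature.AlgebraicGeometry.Motives.AbelianVariety
open NumberField

variable {A : Motives.AbelianVariety ℂ} {F : Type} [Field F]

/-! ## §1 `Λ = H₁(A(ℂ); ℤ)` as an `𝒪_F`-module through `ρ₁ ∘ ι₀` -/

/-- **`a • c = ρ₁(ι₀ a) c = (ι₀ a)_* c`** for the `𝒪_F`-module structure `Module.compHom Λ (ρ₁ ∘ ι₀)` on `Λ = H₁(A(ℂ); ℤ)`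
(unfolding; `ρ₁ = hOneRep A` made a ring homomorphism by ★ `hOneRep_add`). [cite: Shimura1998, §3.1–§3.2] [cite: Lange2023AbelianVarietiesComplex, §1.1.3] -/
theorem hOne_smul_def (ι₀ : 𝓞 F →+* End A) (a : 𝓞 F) (c : singularHomology ℤ ℤ (A.Points ℂ) 1) :
    letI : Module (𝓞 F) (singularHomology ℤ ℤ (A.Points ℂ) 1) :=
      Module.compHom _ ((RingHom.mk' (hOneRep A) hOneRep_add).comp ι₀)
    a • c = hOneRep A (ι₀ a) c :=
  rfl

/-- **`ℤ → 𝒪_F → End_ℤ(Λ)` is a scalar tower**: `(n : 𝒪_F)` acts on `Λ` as multiplication by `n` (`ι₀` and `ρ₁` are unital ring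
homomorphisms, ★ `hOneRep_intCast`). [cite: Lange2023AbelianVarietiesComplex, §1.1.3] -/
theorem isScalarTower_int_hOne (ι₀ : 𝓞 F →+* End A) :
    letI : Module (𝓞 F) (singularHomology ℤ ℤ (A.Points ℂ) 1) :=
      Module.compHom _ ((RingHom.mk' (hOneRep A) hOneRep_add).comp ι₀)
    IsScalarTower ℤ (𝓞 F) (singularHomology ℤ ℤ (A.Points ℂ) 1) := by
  letI : Module (𝓞 F) (singularHomology ℤ ℤ (A.Points ℂ) 1) :=
    Module.compHom _ ((RingHom.mk' (hOneRep A) hOneRep_add).comp ι₀)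
  refine IsScalarTower.of_algebraMap_smul fun (n : ℤ) (c : singularHomology ℤ ℤ (A.Points ℂ) 1) => ?_
  change hOneRep A (ι₀ (algebraMap ℤ (𝓞 F) n)) c = n • c
  rw [algebraMap_int_eq, Int.coe_castRingHom, map_intCast, hOneRep_intCast, Module.End.intCast_apply]

/-- **`Λ = H₁(A(ℂ); ℤ)` is a finitely generated `𝒪_F`-module** (it is finitely generated over `ℤ`, ★ `finite_singularHomology_int`).
[cite: Shimura1998, §3.1–§3.2] [cite: Lange2023AbelianVarietiesComplex, §1.1.3 (1.3)] -/
theorem finite_hOne (ι₀ : 𝓞 F →+* End A) :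
    letI : Module (𝓞 F) (singularHomology ℤ ℤ (A.Points ℂ) 1) :=
      Module.compHom _ ((RingHom.mk' (hOneRep A) hOneRep_add).comp ι₀)
    Module.Finite (𝓞 F) (singularHomology ℤ ℤ (A.Points ℂ) 1) := by
  letI : Module (𝓞 F) (singularHomology ℤ ℤ (A.Points ℂ) 1) :=
    Module.compHom _ ((RingHom.mk' (hOneRep A) hOneRep_add).comp ι₀)
  -- a finite `ℤ`-spanning set spans over `𝒪_F` (written without the scalar tower, to stay clear of the two `ℤ`-module structures)
  obtain ⟨s, hs⟩ := (finite_singularHomology_int A 1).fg_top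
  refine ⟨⟨s, ?_⟩⟩
  rw [eq_top_iff]
  rintro x -
  have hx : x ∈ Submodule.span ℤ (s : Set (singularHomology ℤ ℤ (A.Points ℂ) 1)) := by
    rw [hs]; exact Submodule.mem_top
  induction hx using Submodule.span_induction with
  | mem y hy => exact Submodule.subset_span hy
  | zero => exact Submodule.zero_mem _
  | add y z _ _ hy hz => exact Submodule.add_mem _ hy hz
  | smul n y _ hy =>
    -- `n • y = (n : 𝒪_F) • y` (the `ℤ`-module structure of the homology object versus `zsmul`, then `ρ₁(ι₀ n) = n`)
    have key : (LinearMap.lsmul ℤ (singularHomology ℤ ℤ (A.Points ℂ) 1) n) y = (n : 𝓞 F) • y := by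
      refine (int_smul_eq_zsmul _ n y).trans ?_
      symm
      show hOneRep A (ι₀ (n : 𝓞 F)) y = _
      rw [map_intCast, hOneRep_intCast, Module.End.intCast_apply]
    rw [LinearMap.lsmul_apply] at key
    rw [key]
    exact Submodule.smul_mem _ _ hy

/-- **`Λ = H₁(A(ℂ); ℤ)` has no `ℤ`-torsion** (it is a free `ℤ`-module, ★ `free_singularHomology_int`).
[cite: Lange2023AbelianVarietiesComplex, §1.1.3 (1.3)] -/
theorem isTorsionFree_int_hOne (A : Motives.AbelianVariety ℂ) :
    Module.IsTorsionFree ℤ (singularHomology ℤ ℤ (A.Points ℂ) 1) := by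
  haveI : Module.Free ℤ (singularHomology ℤ ℤ (A.Points ℂ) 1) := free_singularHomology_int A 1
  infer_instance

/-! ## §2 The transfer `Λ ∕ (N)Λ ≅ A[N](ℂ)`, `𝒪_F`-equivariantly; the fixed-point count -/

/-- **`(N)Λ = NΛ`**: membership in the `𝒪_F`-submodule `(N) • Λ` is being an `N`-th multiple.
[cite: Lange2023AbelianVarietiesComplex, §1.1.2 Prop. 1.1.14] -/
theorem mem_span_natCast_smul_top_iff (ι₀ : 𝓞 F →+* End A) (N : ℕ) (c : singularHomology ℤ ℤ (A.Points ℂ) 1) :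
    letI : Module (𝓞 F) (singularHomology ℤ ℤ (A.Points ℂ) 1) :=
      Module.compHom _ ((RingHom.mk' (hOneRep A) hOneRep_add).comp ι₀)
    c ∈ (Ideal.span {(N : 𝓞 F)} • ⊤ : Submodule (𝓞 F) (singularHomology ℤ ℤ (A.Points ℂ) 1)) ↔
      ∃ c' : singularHomology ℤ ℤ (A.Points ℂ) 1, N • c' = c := by
  letI : Module (𝓞 F) (singularHomology ℤ ℤ (A.Points ℂ) 1) :=
    Module.compHom _ ((RingHom.mk' (hOneRep A) hOneRep_add).comp ι₀)
  rw [Submodule.ideal_span_singleton_smul, Submodule.mem_smul_pointwise_iff_exists]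
  constructor
  · rintro ⟨b, -, rfl⟩
    exact ⟨b, (Nat.cast_smul_eq_nsmul (𝓞 F) N b).symm⟩
  · rintro ⟨c', rfl⟩
    exact ⟨c', Submodule.mem_top, Nat.cast_smul_eq_nsmul (𝓞 F) N c'⟩

/-- **THE TRANSFER `Λ ∕ (N)Λ ≅ A[N](ℂ)`, `𝒪_F`-EQUIVARIANTLY** (`N ≥ 1`): there is an additive BIJECTION
`θ : Λ ∕ (N)Λ → A[N](ℂ)` (the tree's monodromy isomorphism `Λ∕NΛ ≅ N⁻¹Λ∕Λ`, ★ `modNHOneEquivTorsionPoints`, read on the quotient by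
the `𝒪_F`-submodule `(N) • Λ = NΛ`) with `θ (a • y) = ι₀(a) (θ y)` for every `a ∈ 𝒪_F` (★ `coe_modNHOneEquivTorsionPoints_mkQ_map`:
«`ρ_r(φ) ⊗ ℤ∕N` is the action of `φ` on `N`-division points»). [cite: Lange2023AbelianVarietiesComplex, §1.1.2 Prop. 1.1.14 and §1.1.3]
[cite: Shimura1998, §7.1] -/
theorem exists_bijective_quotient_to_torsionPoints (ι₀ : 𝓞 F →+* End A) (N : ℕ) (hN : N ≠ 0) :
    letI : Module (𝓞 F) (singularHomology ℤ ℤ (A.Points ℂ) 1) :=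
      Module.compHom _ ((RingHom.mk' (hOneRep A) hOneRep_add).comp ι₀)
    ∃ θ : (singularHomology ℤ ℤ (A.Points ℂ) 1 ⧸
        (Ideal.span {(N : 𝓞 F)} • ⊤ : Submodule (𝓞 F) (singularHomology ℤ ℤ (A.Points ℂ) 1))) →+
        Additive (A.torsionPoints ℂ N),
      Bijective θ ∧
      ∀ (a : 𝓞 F) (y : singularHomology ℤ ℤ (A.Points ℂ) 1 ⧸
        (Ideal.span {(N : 𝓞 F)} • ⊤ : Submodule (𝓞 F) (singularHomology ℤ ℤ (A.Points ℂ) 1))),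
        ((Additive.toMul (θ (a • y)) : A.torsionPoints ℂ N) : A.Points ℂ) =
          IsMonHom.monoidHom (End.asHom (ι₀ a)).hom.hom.hom (specOver ℂ ℂ)
            ((Additive.toMul (θ y) : A.torsionPoints ℂ N) : A.Points ℂ) := by
  letI instO : Module (𝓞 F) (singularHomology ℤ ℤ (A.Points ℂ) 1) :=
    Module.compHom _ ((RingHom.mk' (hOneRep A) hOneRep_add).comp ι₀)
  set P : Submodule (𝓞 F) (singularHomology ℤ ℤ (A.Points ℂ) 1) := Ideal.span {(N : 𝓞 F)} • ⊤ with hP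
  -- `π : Λ → A[N](ℂ)`, `c ↦ e_N [c]`, kills `(N)Λ = NΛ` and descends to the quotient
  have hwd : ∀ c c' : singularHomology ℤ ℤ (A.Points ℂ) 1, P.quotientRel c c' →
      modNHOneEquivTorsionPoints A N hN (ModN.mkQ N c) = modNHOneEquivTorsionPoints A N hN (ModN.mkQ N c') := by
    intro c c' h
    rw [Submodule.quotientRel_def, mem_span_natCast_smul_top_iff ι₀ N] at h
    have h0 : ModN.mkQ N (c - c') = 0 := (modN_mkQ_eq_zero_iff N (c - c')).2 h
    rw [map_sub, sub_eq_zero] at h0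
    rw [h0]
  let θ : (singularHomology ℤ ℤ (A.Points ℂ) 1 ⧸ P) →+ Additive (A.torsionPoints ℂ N) :=
    { toFun := Quotient.lift (fun c => modNHOneEquivTorsionPoints A N hN (ModN.mkQ N c)) hwd
      map_zero' := by
        change modNHOneEquivTorsionPoints A N hN (ModN.mkQ N 0) = 0
        rw [map_zero, map_zero]
      map_add' := by
        intro y y'
        obtain ⟨c, rfl⟩ := Submodule.Quotient.mk_surjective P y
        obtain ⟨c', rfl⟩ := Submodule.Quotient.mk_surjective P y'
        change modNHOneEquivTorsionPoints A N hN (ModN.mkQ N (c + c')) =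
          modNHOneEquivTorsionPoints A N hN (ModN.mkQ N c) + modNHOneEquivTorsionPoints A N hN (ModN.mkQ N c')
        rw [map_add, map_add] }
  have hθ : ∀ c : singularHomology ℤ ℤ (A.Points ℂ) 1,
      θ (Submodule.Quotient.mk c) = modNHOneEquivTorsionPoints A N hN (ModN.mkQ N c) := fun c => rfl
  refine ⟨θ, ⟨?_, ?_⟩, ?_⟩
  · -- injective: `e [c] = 0 ⇒ c ∈ NΛ = (N)Λ`
    rw [injective_iff_map_eq_zero]
    intro y hy
    obtain ⟨c, rfl⟩ := Submodule.Quotient.mk_surjective P y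
    rw [hθ, map_eq_zero_iff _ (modNHOneEquivTorsionPoints A N hN).injective, modN_mkQ_eq_zero_iff] at hy
    exact (Submodule.Quotient.mk_eq_zero P).2 ((mem_span_natCast_smul_top_iff ι₀ N c).2 hy)
  · -- surjective: `c ↦ [c]` and `e_N` are onto
    intro t
    obtain ⟨c, hc⟩ := Quotient.exists_rep ((modNHOneEquivTorsionPoints A N hN).symm t)
    refine ⟨Submodule.Quotient.mk c, ?_⟩
    rw [hθ, show ModN.mkQ N c = (modNHOneEquivTorsionPoints A N hN).symm t from hc, AddEquiv.apply_symm_apply]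
  · -- equivariance: ★ naturality of `Λ/NΛ ≅ A[N](ℂ)` at `φ = ι₀ a`
    intro a y
    obtain ⟨c, rfl⟩ := Submodule.Quotient.mk_surjective P y
    rw [← Submodule.Quotient.mk_smul, hθ, hθ]
    exact coe_modNHOneEquivTorsionPoints_mkQ_map (End.asHom (ι₀ a)) N hN c

/-- **THE FIXED-POINT COUNT TRANSFERS: `#{P ∈ A[N](ℂ) ∕∕ ι₀(a)·P = P} = #{y ∈ Λ ∕ (N)Λ ∕∕ a • y = y}`** (`N ≥ 1`, any `a ∈ 𝒪_F`;
the points are compared inside `A(ℂ)`, `ι₀(a)` acting by the homomorphism it induces on `ℂ`-points).  With `a := a_n` the block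
idempotent of `w ∣ p` and `N := pⁿ` the right-hand side is ★ DEAL 7's count once `Λ ∕ pⁿΛ ≃ₗ[𝒪_F] (𝒪_F ∕ pⁿ)^2` (★ DEAL 8 at rank `2`).
[cite: Shimura1998, §7.1] [cite: Lange2023AbelianVarietiesComplex, §1.1.2 Prop. 1.1.14 and §1.1.3] -/
theorem natCard_fixedPoints_torsionPoints_eq (ι₀ : 𝓞 F →+* End A) (a : 𝓞 F) (N : ℕ) (hN : N ≠ 0) :
    letI : Module (𝓞 F) (singularHomology ℤ ℤ (A.Points ℂ) 1) :=
      Module.compHom _ ((RingHom.mk' (hOneRep A) hOneRep_add).comp ι₀)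
    Nat.card {P : A.torsionPoints ℂ N //
        IsMonHom.monoidHom (End.asHom (ι₀ a)).hom.hom.hom (specOver ℂ ℂ) (P : A.Points ℂ) = P} =
      Nat.card {y : singularHomology ℤ ℤ (A.Points ℂ) 1 ⧸
        (Ideal.span {(N : 𝓞 F)} • ⊤ : Submodule (𝓞 F) (singularHomology ℤ ℤ (A.Points ℂ) 1)) // a • y = y} := by
  letI instO : Module (𝓞 F) (singularHomology ℤ ℤ (A.Points ℂ) 1) :=
    Module.compHom _ ((RingHom.mk' (hOneRep A) hOneRep_add).comp ι₀)
  obtain ⟨θ, hθb, hθa⟩ := exists_bijective_quotient_to_torsionPoints ι₀ N hN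
  symm
  refine Nat.card_congr ((Equiv.ofBijective θ hθb).subtypeEquiv fun y => ?_)
  rw [Equiv.ofBijective_apply]
  constructor
  · intro h
    have h' := hθa a y
    rw [h] at h'
    exact h'.symm
  · intro h
    apply hθb.1
    apply Additive.toMul.injective
    apply Subtype.ext
    rw [hθa a y]
    exact h

end AbelianVariety

end Literature.AlgebraicGeometry.HodgeTheory
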